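import Literature.MathematicalPhysics.QuantumLattice.LiebWuFiniteBNeumannSeries
import HarnessLib

/-!
# The resolvent `(1 + K̂²B̂)⁻¹` of Lieb–Wu's proof of Lemma 2, as a Neumann series

Family `hubbard`. Lieb–Wu, Physica A 321 (2003) 1, §5, proof of Lemma 2 (Monotonicity in `B`): "Consider
equation (S) for the case `A = 0`. Theorem 1 and Lemma 1 hold in this case, of course. We also note that
their proofs do not depend on any particular fact about the function `Dt`, other than the fact that it is
a non-negative function. From these observations we learn that the solution to the equation
`(1 + K̂²B̂) S = K̂g` (general) has the property, for all `x ∈ ℝ`, that `S(x) ≥ 0` and that `S(x)` is a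
non-increasing function of `B`, provided only that `g(x) ≥ 0` for all `x ∈ ℝ`. Another way to say this is
that the integral kernel of `V̂ = (1 + K̂²B̂)⁻¹` is positive and is a pointwise monotone decreasing function
of `B`."

With `R̂ = K̂(1 + K̂²)⁻¹` (kernel `r/2`) and `Û = K̂²(1 + K̂²)⁻¹` (kernel `u`), eq. (general) reads
`S = R̂g + Û(1 - B̂)S`; this file solves the fixed-point equation **`V = ζ + Û(1 - B̂)V`** for a general
continuous, nonnegative, bounded, integrable source `ζ` (for eq. (general), `ζ = R̂g`) and an arbitrary
measurable rapidity set `S` (`B̂` = multiplication by `1_S`) by the Neumann series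
`V = Σₙ (Û(1 - B̂))ⁿ ζ` — "the case `A = 0`" of `LiebWuFiniteBNeumannSeries`:

* `liebWuT U S h = u ∗ (1_{Sᶜ} h)` (the operator `Û(1 - B̂)`), `liebWuResolventTerm`, `liebWuResolvent U S ζ = V`;
* PROVED: `Û(1 - B̂)` maps nonnegative integrable functions to continuous nonnegative integrable ones with
  `∫ ≤ ½∫` and `sup ≤ (1/(2πc))∫`, is additive, monotone, and antitone in `S`; the terms are continuous,
  nonnegative, integrable with geometric bounds; `V` is continuous, `ζ ≤ V`, integrable, `∫V ≤ 2∫ζ`, and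
  **`V = ζ + Û(1 - B̂)V`** (`liebWuResolvent_eq`).

Additivity / monotonicity in `ζ`, antitonicity in `S` and uniqueness of the fixed point are in the companion
file `LiebWuResolventMonotone`. No named fact.

## References

* E. H. Lieb, F. Y. Wu, Physica A 321 (2003) 1–27 = arXiv:cond-mat/0207529, §5, proof of Lemma 2, eqs.
  (general), (S), (series) (key `LiebWuPhysicaA2003`).
-/

noncomputable section

open MeasureTheory Set Real Filter intervalIntegral
open Literature.Analysis.SpecialFunctions
open scoped Convolution Topology

namespace Literature.MathematicalPhysics.QuantumLattice

namespace LiebWuResolv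

variable {f g : ℝ → ℝ} {B : ℝ}

/-- `t ↦ f(t) g(x - t)` is integrable for `f ∈ L¹`, `g` bounded continuous. [folklore] -/
private theorem integrable_mul_sub₇ (hf : Integrable f) (hgc : Continuous g) (hgB : ∀ y, |g y| ≤ B)
    (x : ℝ) : Integrable fun t => f t * g (x - t) :=
  hf.mul_bdd (hgc.comp (continuous_const.sub continuous_id)).aestronglyMeasurable
    (Eventually.of_forall fun t => by rw [Real.norm_eq_abs]; exact hgB _)

/-- `x ↦ ∫ f(t) g(x - t) dt` is Mathlib's convolution for the multiplication pairing. [folklore] -/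
private theorem conv_eq_convolution₇ (f g : ℝ → ℝ) :
    (fun x => ∫ t, f t * g (x - t)) = f ⋆[ContinuousLinearMap.mul ℝ ℝ, volume] g := by
  funext x
  rw [convolution_def]
  simp only [ContinuousLinearMap.mul_apply']

/-- `x ↦ ∫ f(t) g(x - t) dt` is continuous for `f ∈ L¹`, `g` bounded continuous. [folklore] -/
private theorem continuous_conv₇ (hf : Integrable f) (hgc : Continuous g) (hgB : ∀ y, |g y| ≤ B) :
    Continuous fun x => ∫ t, f t * g (x - t) := by
  rw [conv_eq_convolution₇]
  refine BddAbove.continuous_convolution_right_of_integrable (L := ContinuousLinearMap.mul ℝ ℝ)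
    ⟨B, ?_⟩ hf hgc
  rintro _ ⟨y, rfl⟩
  exact (Real.norm_eq_abs _).trans_le (hgB y)

/-- `∫∫ f(t) g(x - t) dt dx = (∫ f)(∫ g)` for `f, g ∈ L¹`, and the convolution is integrable. [folklore] -/
private theorem integrable_conv_and_integral₇ (hf : Integrable f) (hg : Integrable g) :
    Integrable (fun x => ∫ t, f t * g (x - t)) ∧
      ∫ x, ∫ t, f t * g (x - t) = (∫ t, f t) * ∫ y, g y := by
  rw [conv_eq_convolution₇]
  exact ⟨hf.integrable_convolution _ hg, by
    rw [integral_convolution (L := ContinuousLinearMap.mul ℝ ℝ) hf hg]; rfl⟩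

/-- `0 ≤ ∫ f(t) g(x - t) dt ≤ B ∫ f` for `f, g ≥ 0`, `g ≤ B`, `f ∈ L¹`. [folklore] -/
private theorem conv_nonneg_le₇ (hf : Integrable f) (hf0 : ∀ t, 0 ≤ f t) (hg0 : ∀ y, 0 ≤ g y)
    (hgB : ∀ y, g y ≤ B) (x : ℝ) :
    0 ≤ ∫ t, f t * g (x - t) ∧ ∫ t, f t * g (x - t) ≤ B * ∫ t, f t := by
  refine ⟨integral_nonneg fun t => mul_nonneg (hf0 t) (hg0 _), ?_⟩
  rw [← MeasureTheory.integral_const_mul]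
  refine integral_mono_of_nonneg (Eventually.of_forall fun t => mul_nonneg (hf0 t) (hg0 _))
    (hf.const_mul B) (Eventually.of_forall fun t => ?_)
  dsimp only
  rw [mul_comm B]
  exact mul_le_mul_of_nonneg_left (hgB _) (hf0 t)

end LiebWuResolv

open LiebWuResolv

/-- The operator **`Û(1 - B̂)`** for the rapidity set `S`: `(u ∗ 1_{Sᶜ}h)(x) = ∫ 1_{Sᶜ}(t) h(t) u_{U/4}(x - t) dt`.
[cite: LiebWuPhysicaA2003, §5, proof of Lemma 2, eq. (general)] -/
def liebWuT (U : ℝ) (S : Set ℝ) (h : ℝ → ℝ) (x : ℝ) : ℝ :=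
  ∫ t, Sᶜ.indicator h t * fermiKernel (U / 4) (x - t)

/-- The Neumann terms `(Û(1 - B̂))ⁿ ζ`. [cite: LiebWuPhysicaA2003, §5, proof of Lemma 2] -/
def liebWuResolventTerm (U : ℝ) (S : Set ℝ) (ζ : ℝ → ℝ) : ℕ → ℝ → ℝ
  | 0 => ζ
  | n + 1 => liebWuT U S (liebWuResolventTerm U S ζ n)

/-- **`V = Σₙ (Û(1 - B̂))ⁿ ζ`**, the solution of `V = ζ + Û(1 - B̂)V` (for `ζ = R̂g`: the solution `S = V̂K̂g`
of eq. (general)). [cite: LiebWuPhysicaA2003, §5, proof of Lemma 2] -/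
def liebWuResolvent (U : ℝ) (S : Set ℝ) (ζ : ℝ → ℝ) (x : ℝ) : ℝ :=
  ∑' n, liebWuResolventTerm U S ζ n x

variable {U : ℝ} {S : Set ℝ} {h ζ : ℝ → ℝ} {M : ℝ}

/-! ### The operator `Û(1 - B̂)` -/

/-- **`Û(1 - B̂)` on nonnegative integrable functions:** continuous, nonnegative, integrable, with
`∫ ≤ ½ ∫ h` (`∫u = ½`) and `sup ≤ (1/(2πc)) ∫ h` (`u ≤ 1/(2πc)`), `c = U/4`.
[cite: LiebWuPhysicaA2003, §5, proof of Lemma 2] -/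
theorem liebWuT_props (hU : 0 < U) (hS : MeasurableSet S) (hhi : Integrable h) (hh0 : ∀ t, 0 ≤ h t) :
    Continuous (liebWuT U S h) ∧ (∀ x, 0 ≤ liebWuT U S h x) ∧ Integrable (liebWuT U S h) ∧
      (∫ x, liebWuT U S h x) ≤ 1 / 2 * ∫ t, h t ∧ ∀ x, liebWuT U S h x ≤ 1 / (2 * π * (U / 4)) * ∫ t, h t := by
  have hc : 0 < U / 4 := by positivity
  have h2i : Integrable (Sᶜ.indicator h) := hhi.indicator hS.compl
  have h20 : ∀ t, 0 ≤ Sᶜ.indicator h t := fun t => indicator_nonneg (fun s _ => hh0 s) _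
  have hI2 : ∫ t, Sᶜ.indicator h t ≤ ∫ t, h t :=
    integral_mono h2i hhi fun t => indicator_le_self' (fun s _ => hh0 s) t
  have hI0 : 0 ≤ ∫ t, Sᶜ.indicator h t := integral_nonneg h20
  have huB : ∀ y, |fermiKernel (U / 4) y| ≤ 1 / (2 * π * (U / 4)) := fun y => by
    rw [abs_of_nonneg (fermiKernel_nonneg hc y)]; exact fermiKernel_le hc y
  obtain ⟨hWi, hWint⟩ := integrable_conv_and_integral₇ h2i (integrable_fermiKernel hc)
  rw [integral_fermiKernel hc] at hWint
  have hW := fun x => conv_nonneg_le₇ h2i h20 (fermiKernel_nonneg hc) (fermiKernel_le hc) x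
  refine ⟨continuous_conv₇ h2i (continuous_fermiKernel hc) huB, fun x => (hW x).1, hWi, ?_, fun x => ?_⟩
  · show (∫ x, ∫ t, Sᶜ.indicator h t * fermiKernel (U / 4) (x - t)) ≤ 1 / 2 * ∫ t, h t
    rw [hWint]; linarith
  · exact (hW x).2.trans (mul_le_mul_of_nonneg_left hI2 (by positivity))

/-- `Û(1 - B̂)` is additive. [cite: LiebWuPhysicaA2003, §5, proof of Lemma 2] -/
theorem liebWuT_add (hU : 0 < U) (hS : MeasurableSet S) {h₁ h₂ : ℝ → ℝ} (h₁i : Integrable h₁)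
    (h₂i : Integrable h₂) (x : ℝ) :
    liebWuT U S (fun t => h₁ t + h₂ t) x = liebWuT U S h₁ x + liebWuT U S h₂ x := by
  have hc : 0 < U / 4 := by positivity
  have huB : ∀ y, |fermiKernel (U / 4) y| ≤ 1 / (2 * π * (U / 4)) := fun y => by
    rw [abs_of_nonneg (fermiKernel_nonneg hc y)]; exact fermiKernel_le hc y
  rw [liebWuT, liebWuT, liebWuT, ← integral_add (integrable_mul_sub₇ (h₁i.indicator hS.compl)
    (continuous_fermiKernel hc) huB x) (integrable_mul_sub₇ (h₂i.indicator hS.compl) (continuous_fermiKernel hc) huB x)]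
  refine MeasureTheory.integral_congr_ae (Eventually.of_forall fun t => ?_)
  beta_reduce
  by_cases ht : t ∈ Sᶜ
  · simp only [indicator_of_mem ht]; ring
  · simp only [indicator_of_notMem ht]; ring

/-- `Û(1 - B̂)` is monotone (positive kernel). [cite: LiebWuPhysicaA2003, §5, proof of Lemma 2] -/
theorem liebWuT_mono (hU : 0 < U) (hS : MeasurableSet S) {h₁ h₂ : ℝ → ℝ} (h₁i : Integrable h₁)
    (h₂i : Integrable h₂) (hle : ∀ t, h₁ t ≤ h₂ t) (x : ℝ) : liebWuT U S h₁ x ≤ liebWuT U S h₂ x := by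
  have hc : 0 < U / 4 := by positivity
  have huB : ∀ y, |fermiKernel (U / 4) y| ≤ 1 / (2 * π * (U / 4)) := fun y => by
    rw [abs_of_nonneg (fermiKernel_nonneg hc y)]; exact fermiKernel_le hc y
  exact integral_mono (integrable_mul_sub₇ (h₁i.indicator hS.compl) (continuous_fermiKernel hc) huB x)
    (integrable_mul_sub₇ (h₂i.indicator hS.compl) (continuous_fermiKernel hc) huB x)
    fun t => mul_le_mul_of_nonneg_right (indicator_le_indicator' fun _ => hle t) (fermiKernel_nonneg hc _)

/-- `Û(1 - B̂)` decreases as the range grows: `S ⊆ S'`, `h ≥ 0` ⇒ `Û(1 - B̂')h ≤ Û(1 - B̂)h`.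
[cite: LiebWuPhysicaA2003, §5, proof of Lemma 2] -/
theorem liebWuT_antitone_set (hU : 0 < U) {S' : Set ℝ} (hS : MeasurableSet S) (hS' : MeasurableSet S')
    (hSS' : S ⊆ S') (hhi : Integrable h) (hh0 : ∀ t, 0 ≤ h t) (x : ℝ) : liebWuT U S' h x ≤ liebWuT U S h x := by
  have hc : 0 < U / 4 := by positivity
  have huB : ∀ y, |fermiKernel (U / 4) y| ≤ 1 / (2 * π * (U / 4)) := fun y => by
    rw [abs_of_nonneg (fermiKernel_nonneg hc y)]; exact fermiKernel_le hc y
  exact integral_mono (integrable_mul_sub₇ (hhi.indicator hS'.compl) (continuous_fermiKernel hc) huB x)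
    (integrable_mul_sub₇ (hhi.indicator hS.compl) (continuous_fermiKernel hc) huB x)
    fun t => mul_le_mul_of_nonneg_right
      (indicator_le_indicator_of_subset (compl_subset_compl.2 hSS') (fun s => hh0 s) t) (fermiKernel_nonneg hc _)

/-! ### The terms and the series -/

/-- **Term-wise bounds**: for a continuous nonnegative integrable source `ζ`, each `(Û(1 - B̂))ⁿζ` is
continuous, nonnegative, integrable, with `∫ ≤ 2⁻ⁿ ∫ζ`. [cite: LiebWuPhysicaA2003, §5, proof of Lemma 2] -/
theorem liebWuResolventTerm_props (hU : 0 < U) (hS : MeasurableSet S) (hζc : Continuous ζ)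
    (hζ0 : ∀ x, 0 ≤ ζ x) (hζi : Integrable ζ) (n : ℕ) :
    Continuous (liebWuResolventTerm U S ζ n) ∧ (∀ x, 0 ≤ liebWuResolventTerm U S ζ n x) ∧
      Integrable (liebWuResolventTerm U S ζ n) ∧
      (∫ x, liebWuResolventTerm U S ζ n x) ≤ (1 / 2) ^ n * ∫ x, ζ x := by
  induction n with
  | zero => exact ⟨hζc, hζ0, hζi, by simp [liebWuResolventTerm]⟩
  | succ n ih =>
    obtain ⟨_, h0, hi, hint⟩ := ih
    obtain ⟨hc', h0', hi', hint', _⟩ := liebWuT_props hU hS hi h0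
    refine ⟨hc', h0', hi', ?_⟩
    calc (∫ x, liebWuResolventTerm U S ζ (n + 1) x) = ∫ x, liebWuT U S (liebWuResolventTerm U S ζ n) x := rfl
      _ ≤ 1 / 2 * ∫ x, liebWuResolventTerm U S ζ n x := hint'
      _ ≤ 1 / 2 * ((1 / 2) ^ n * ∫ x, ζ x) := mul_le_mul_of_nonneg_left hint (by norm_num)
      _ = (1 / 2) ^ (n + 1) * ∫ x, ζ x := by ring

/-- **Uniform bound**: `(Û(1 - B̂))ⁿ⁺¹ζ(x) ≤ (1/(2πc)) 2⁻ⁿ ∫ζ`. [cite: LiebWuPhysicaA2003, §5, proof of Lemma 2] -/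
theorem liebWuResolventTerm_succ_le (hU : 0 < U) (hS : MeasurableSet S) (hζc : Continuous ζ)
    (hζ0 : ∀ x, 0 ≤ ζ x) (hζi : Integrable ζ) (n : ℕ) (x : ℝ) :
    liebWuResolventTerm U S ζ (n + 1) x ≤ 1 / (2 * π * (U / 4)) * ((1 / 2) ^ n * ∫ y, ζ y) := by
  obtain ⟨_, h0, hi, hint⟩ := liebWuResolventTerm_props hU hS hζc hζ0 hζi n
  obtain ⟨_, _, _, _, hsup⟩ := liebWuT_props hU hS hi h0
  exact (hsup x).trans (mul_le_mul_of_nonneg_left hint (by positivity))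

/-- The summable majorant: `‖(Û(1 - B̂))ⁿζ(x)‖ ≤ 2(M + (1/(2πc))∫ζ) 2⁻ⁿ` for `ζ ≤ M`.
[cite: LiebWuPhysicaA2003, §5, proof of Lemma 2] -/
theorem liebWuResolventTerm_le_majorant (hU : 0 < U) (hS : MeasurableSet S) (hζc : Continuous ζ)
    (hζ0 : ∀ x, 0 ≤ ζ x) (hζi : Integrable ζ) (hζM : ∀ x, ζ x ≤ M) (n : ℕ) (x : ℝ) :
    ‖liebWuResolventTerm U S ζ n x‖ ≤ 2 * (M + 1 / (2 * π * (U / 4)) * ∫ y, ζ y) * (1 / 2) ^ n := by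
  have hI : 0 ≤ ∫ y, ζ y := integral_nonneg hζ0
  have hM0 : 0 ≤ M := (hζ0 0).trans (hζM 0)
  have hM1 : 0 ≤ 1 / (2 * π * (U / 4)) * ∫ y, ζ y := by positivity
  rw [Real.norm_eq_abs, abs_of_nonneg ((liebWuResolventTerm_props hU hS hζc hζ0 hζi n).2.1 x)]
  cases n with
  | zero =>
    simp only [liebWuResolventTerm, pow_zero, mul_one]
    linarith [hζM x]
  | succ n =>
    have hp : (0 : ℝ) ≤ (1 / 2) ^ n := by positivity
    calc liebWuResolventTerm U S ζ (n + 1) x ≤ 1 / (2 * π * (U / 4)) * ((1 / 2) ^ n * ∫ y, ζ y) :=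
          liebWuResolventTerm_succ_le hU hS hζc hζ0 hζi n x
      _ = 2 * (1 / (2 * π * (U / 4)) * ∫ y, ζ y) * (1 / 2) ^ (n + 1) := by ring
      _ ≤ _ := by
          rw [pow_succ]
          nlinarith [hM0, hM1, hp]

/-- The series converges pointwise absolutely (and uniformly). [cite: LiebWuPhysicaA2003, §5, proof of Lemma 2] -/
theorem summable_liebWuResolventTerm (hU : 0 < U) (hS : MeasurableSet S) (hζc : Continuous ζ)
    (hζ0 : ∀ x, 0 ≤ ζ x) (hζi : Integrable ζ) (hζM : ∀ x, ζ x ≤ M) (x : ℝ) :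
    Summable fun n => liebWuResolventTerm U S ζ n x :=
  Summable.of_norm_bounded ((summable_geometric_of_lt_one (by norm_num) (by norm_num)).mul_left _)
    (fun n => liebWuResolventTerm_le_majorant hU hS hζc hζ0 hζi hζM n x)

/-- **`V` is continuous.** [cite: LiebWuPhysicaA2003, §5, proof of Lemma 2] -/
theorem continuous_liebWuResolvent (hU : 0 < U) (hS : MeasurableSet S) (hζc : Continuous ζ)
    (hζ0 : ∀ x, 0 ≤ ζ x) (hζi : Integrable ζ) (hζM : ∀ x, ζ x ≤ M) : Continuous (liebWuResolvent U S ζ) :=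
  continuous_tsum (fun n => (liebWuResolventTerm_props hU hS hζc hζ0 hζi n).1)
    ((summable_geometric_of_lt_one (by norm_num) (by norm_num)).mul_left _)
    (fun n x => liebWuResolventTerm_le_majorant hU hS hζc hζ0 hζi hζM n x)

/-- **`ζ ≤ V`** (all terms are nonnegative); in particular `V ≥ 0` ("`S(x) ≥ 0`").
[cite: LiebWuPhysicaA2003, §5, proof of Lemma 2] -/
theorem le_liebWuResolvent (hU : 0 < U) (hS : MeasurableSet S) (hζc : Continuous ζ) (hζ0 : ∀ x, 0 ≤ ζ x)
    (hζi : Integrable ζ) (hζM : ∀ x, ζ x ≤ M) (x : ℝ) : ζ x ≤ liebWuResolvent U S ζ x := by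
  rw [liebWuResolvent, (summable_liebWuResolventTerm hU hS hζc hζ0 hζi hζM x).tsum_eq_zero_add]
  exact le_add_of_nonneg_right (tsum_nonneg fun n => (liebWuResolventTerm_props hU hS hζc hζ0 hζi (n + 1)).2.1 x)

/-- The integrals of the terms are summable. [cite: LiebWuPhysicaA2003, §5, proof of Lemma 2] -/
theorem summable_integral_liebWuResolventTerm (hU : 0 < U) (hS : MeasurableSet S) (hζc : Continuous ζ)
    (hζ0 : ∀ x, 0 ≤ ζ x) (hζi : Integrable ζ) :
    Summable fun n => ∫ x, ‖liebWuResolventTerm U S ζ n x‖ := by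
  refine Summable.of_nonneg_of_le (fun n => integral_nonneg fun x => norm_nonneg _) (fun n => ?_)
    ((summable_geometric_of_lt_one (by norm_num : (0 : ℝ) ≤ 1 / 2) (by norm_num)).mul_right (∫ x, ζ x))
  have h := liebWuResolventTerm_props hU hS hζc hζ0 hζi n
  calc ∫ x, ‖liebWuResolventTerm U S ζ n x‖ = ∫ x, liebWuResolventTerm U S ζ n x :=
        integral_congr_ae (Eventually.of_forall fun x => Real.norm_of_nonneg (h.2.1 x))
    _ ≤ (1 / 2) ^ n * ∫ x, ζ x := h.2.2.2

/-- **`V ∈ L¹`.** [cite: LiebWuPhysicaA2003, §5, proof of Lemma 2] -/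
theorem integrable_liebWuResolvent (hU : 0 < U) (hS : MeasurableSet S) (hζc : Continuous ζ)
    (hζ0 : ∀ x, 0 ≤ ζ x) (hζi : Integrable ζ) (hζM : ∀ x, ζ x ≤ M) : Integrable (liebWuResolvent U S ζ) := by
  have hprops := liebWuResolventTerm_props hU hS hζc hζ0 hζi
  have hsum := summable_integral_liebWuResolventTerm hU hS hζc hζ0 hζi
  have hV0 : ∀ x, 0 ≤ liebWuResolvent U S ζ x := fun x => (hζ0 x).trans (le_liebWuResolvent hU hS hζc hζ0 hζi hζM x)
  refine (lintegral_ofReal_ne_top_iff_integrable (continuous_liebWuResolvent hU hS hζc hζ0 hζi hζM).aestronglyMeasurable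
    (Eventually.of_forall hV0)).1 ?_
  have h1 : ∀ x, ENNReal.ofReal (liebWuResolvent U S ζ x) = ∑' n, ENNReal.ofReal (liebWuResolventTerm U S ζ n x) :=
    fun x => ENNReal.ofReal_tsum_of_nonneg (fun n => (hprops n).2.1 x) (summable_liebWuResolventTerm hU hS hζc hζ0 hζi hζM x)
  simp_rw [h1]
  rw [lintegral_tsum fun n => (hprops n).1.measurable.ennreal_ofReal.aemeasurable]
  have h2 : ∀ n, ∫⁻ x, ENNReal.ofReal (liebWuResolventTerm U S ζ n x) =
      ENNReal.ofReal (∫ x, ‖liebWuResolventTerm U S ζ n x‖) := fun n => by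
    rw [← ofReal_integral_eq_lintegral_ofReal (hprops n).2.2.1 (Eventually.of_forall (hprops n).2.1)]
    congr 1
    exact integral_congr_ae (Eventually.of_forall fun x => (Real.norm_of_nonneg ((hprops n).2.1 x)).symm)
  simp_rw [h2]
  rw [← ENNReal.ofReal_tsum_of_nonneg (fun n => integral_nonneg fun x => norm_nonneg _) hsum]
  exact ENNReal.ofReal_ne_top

/-- `∫ V = Σ ∫ (Û(1 - B̂))ⁿζ ≤ 2 ∫ζ`. [cite: LiebWuPhysicaA2003, §5, proof of Lemma 2] -/
theorem integral_liebWuResolvent_le (hU : 0 < U) (hS : MeasurableSet S) (hζc : Continuous ζ)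
    (hζ0 : ∀ x, 0 ≤ ζ x) (hζi : Integrable ζ) : ∫ x, liebWuResolvent U S ζ x ≤ 2 * ∫ x, ζ x := by
  have hprops := liebWuResolventTerm_props hU hS hζc hζ0 hζi
  have hsum := summable_integral_liebWuResolventTerm hU hS hζc hζ0 hζi
  have h := integral_tsum_of_summable_integral_norm (fun n => (hprops n).2.2.1) hsum
  have hfun : (fun x => ∑' n, liebWuResolventTerm U S ζ n x) = liebWuResolvent U S ζ := rfl
  rw [hfun] at h
  rw [← h]
  have hgeom : HasSum (fun n : ℕ => (1 / 2 : ℝ) ^ n * ∫ x, ζ x) (2 * ∫ x, ζ x) :=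
    hasSum_geometric_two.mul_right (∫ x, ζ x)
  refine (Summable.tsum_le_tsum (fun n => (hprops n).2.2.2) ?_ hgeom.summable).trans_eq hgeom.tsum_eq
  refine hsum.congr fun n => ?_
  exact integral_congr_ae (Eventually.of_forall fun x => Real.norm_of_nonneg ((hprops n).2.1 x))

/-- **The fixed-point equation: `V = ζ + Û(1 - B̂)V`** (`Û(1 - B̂)` passes through the `L¹`-convergent sum).
[cite: LiebWuPhysicaA2003, §5, proof of Lemma 2, eq. (general)] -/
theorem liebWuResolvent_eq (hU : 0 < U) (hS : MeasurableSet S) (hζc : Continuous ζ) (hζ0 : ∀ x, 0 ≤ ζ x)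
    (hζi : Integrable ζ) (hζM : ∀ x, ζ x ≤ M) (x : ℝ) :
    liebWuResolvent U S ζ x = ζ x + liebWuT U S (liebWuResolvent U S ζ) x := by
  have hc : 0 < U / 4 := by positivity
  have hprops := liebWuResolventTerm_props hU hS hζc hζ0 hζi
  have hsumI := summable_integral_liebWuResolventTerm hU hS hζc hζ0 hζi
  have huB : ∀ y, |fermiKernel (U / 4) y| ≤ 1 / (2 * π * (U / 4)) := fun y => by
    rw [abs_of_nonneg (fermiKernel_nonneg hc y)]; exact fermiKernel_le hc y
  set T : ℕ → ℝ → ℝ := liebWuResolventTerm U S ζ with hT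
  have hTci : ∀ n, Integrable (Sᶜ.indicator (T n)) := fun n => (hprops n).2.2.1.indicator hS.compl
  have hsumS : Summable fun n => ∫ t, ‖Sᶜ.indicator (T n) t‖ := by
    refine Summable.of_nonneg_of_le (fun n => integral_nonneg fun t => norm_nonneg _)
      (fun n => integral_mono ((hprops n).2.2.1.indicator hS.compl).norm (hprops n).2.2.1.norm fun t => ?_) hsumI
    rw [Real.norm_eq_abs, Real.norm_eq_abs, abs_of_nonneg (indicator_nonneg (fun s _ => (hprops n).2.1 s) _),
      abs_of_nonneg ((hprops n).2.1 t)]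
    exact indicator_le_self' (fun s _ => (hprops n).2.1 s) _
  have hind : ∀ t, Sᶜ.indicator (liebWuResolvent U S ζ) t = ∑' n, Sᶜ.indicator (T n) t := by
    intro t
    by_cases ht : t ∈ Sᶜ
    · simp only [indicator_of_mem ht, liebWuResolvent, hT]
    · simp only [indicator_of_notMem ht, tsum_zero]
  have hTV : liebWuT U S (liebWuResolvent U S ζ) x = ∑' n, ∫ t, Sᶜ.indicator (T n) t * fermiKernel (U / 4) (x - t) := by
    rw [liebWuT, integral_tsum_of_summable_integral_norm (fun n => integrable_mul_sub₇ (hTci n)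
      (continuous_fermiKernel hc) huB x) ?_]
    · refine integral_congr_ae (Eventually.of_forall fun t => ?_)
      beta_reduce
      rw [hind t]
      exact tsum_mul_right.symm
    · refine Summable.of_nonneg_of_le (fun n => integral_nonneg fun t => norm_nonneg _) (fun n => ?_)
        (hsumS.mul_right (1 / (2 * π * (U / 4))))
      rw [← MeasureTheory.integral_mul_const]
      refine integral_mono ((integrable_mul_sub₇ (hTci n) (continuous_fermiKernel hc) huB x).norm)
        ((hTci n).norm.mul_const _) fun t => ?_
      dsimp only
      rw [norm_mul]
      exact mul_le_mul_of_nonneg_left (by rw [Real.norm_eq_abs]; exact huB _) (norm_nonneg _)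
  rw [hTV, liebWuResolvent, (summable_liebWuResolventTerm hU hS hζc hζ0 hζi hζM x).tsum_eq_zero_add]
  rfl

end Literature.MathematicalPhysics.QuantumLattice

end
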